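import Summits.QuantumFields.QCD.Theorems.HeatSlicedQuarksQuarkLoopCoefficientSecondOrderExpansionAuxH
import Summits.QuantumFields.QCD.Theorems.HeatSlicedQuarksQuarkLoopCoefficientSecondOrderExpansionAuxD

/-!
# Second-order expansion of the heat symbol — part I: profile bounds of the fields
(line `Sketch` of crux stmt-QuantumFields-16786, stub `stub_secondOrderExpansion`, helper file)

Given the free-kernel majorant `|k_t(w)| ≤ C_k Γ_c(t,w)` and the profile calculus of the toolkit
(moment absorption (3), bounded shifts (4)), entrywise Gaussian-profile bounds of

* `E₀ = pert0` (`≤ C Γ`), `E₁ = pert1` (`≤ C (1+s) Γ`), the exact first-order vertex on `E₁`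
  (`‖vtx 1 (pert1 s)‖ ≤ C (1+s) Γ`, no Moyal loss),
* the generic vertex `vtx j f` and the cocycle remainder `V_θ f − Σ_{j<m} θʲ vtx j f` on a profile-bounded
  field (`(1+|w|)ʲ` costs `(1+s)^k`, `j ≤ 2k`).

Each step halves the profile constant (`ε = 1/2` in the toolkit).
-/

noncomputable section

namespace Summit.QuantumFields.QCD.Cruxes.QuarkLoopCoefficient.Sketch.SecondOrderExpansion

open Literature.MathematicalPhysics.QuantumLattice Literature.MathematicalPhysics.QuantumFieldTheory
open Literature.Probability.LatticeModels (Site)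
open Summit.QuantumFields.QCD.Theorems.QuarkLoopCoefficient
open Summit.QuantumFields.QCD.Cruxes.QuarkLoopCoefficient.Sketch.HeatSeries
open Summit.QuantumFields.QCD.Cruxes.QuarkLoopCoefficient.Sketch.FreeMajorantToolkit
open Summit.QuantumFields.QCD.Cruxes.QuarkLoopCoefficient.Sketch.SymmetricGauge
open scoped Matrix ComplexConjugate

/-- The first-order matrix kernel `η(v) = Σ_{z ∈ nbr 0} (z∧v) • ď♯(z) ď(v−z)` (local notation). -/
local notation "η[" v "]" => (∑ z ∈ nbr 0, ((wedge z v : ℤ) : ℂ) • (dsharp z * dsymb (v - z)))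

/-- The twisted generator `(V_θ f)(w) = Σ_{v ∈ nbr2 0} Ω_θ(v, w) • (ȟ_θ(v) f(w − v))` (local notation). -/
local notation "V[" θ "]" => (fun (f : Site 4 → Spin) (w : Site 4) =>
  ∑ v ∈ nbr2 0, Complex.exp (((θ / 2 * (wedge v w : ℤ) : ℝ) : ℂ) * Complex.I) • (sqKer (symLink θ) 0 v * f (w - v)))

/-! ## §19 Profile tools -/

/-- `√(1+t)ʲ ≤ (1+t)ᵏ` for `j ≤ 2k`, `t ≥ 0`. -/
theorem sqrt_one_add_pow_le {t : ℝ} (ht : 0 ≤ t) {j k : ℕ} (hjk : j ≤ 2 * k) :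
    Real.sqrt (1 + t) ^ j ≤ (1 + t) ^ k := by
  have h1 : 1 ≤ Real.sqrt (1 + t) := by rw [Real.one_le_sqrt]; linarith
  calc Real.sqrt (1 + t) ^ j ≤ Real.sqrt (1 + t) ^ (2 * k) := pow_le_pow_right₀ h1 hjk
    _ = (1 + t) ^ k := by rw [pow_mul, Real.sq_sqrt (by linarith)]

/-- **Shift sums**: `Σ_{v ∈ nbr2 0} Γ_c(t, w − v) ≤ A Γ_{c/2}(t, w)` (toolkit (4) with `ε = 1/2`). -/
theorem exists_sum_nbr2_gaussProfile_le
    (hT4 : ∀ c ε : ℝ, 0 < c → 0 < ε → ε < 1 → ∃ A : ℝ, ∀ t : ℝ, 0 ≤ t → ∀ w z : Site 4, elen z ≤ 2 →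
      gaussProfile c t (w + z) ≤ A * gaussProfile ((1 - ε) * c) t w)
    {c : ℝ} (hc : 0 < c) :
    ∃ A : ℝ, 0 ≤ A ∧ ∀ t : ℝ, 0 ≤ t → ∀ w : Site 4,
      ∑ v ∈ nbr2 0, gaussProfile c t (w - v) ≤ A * gaussProfile (c / 2) t w := by
  obtain ⟨A, hA⟩ := hT4 c (1 / 2) hc (by norm_num) (by norm_num)
  have hc2 : (1 - 1 / 2) * c = c / 2 := by ring
  rw [hc2] at hA
  refine ⟨81 * max A 0, by positivity, fun t ht w => ?_⟩
  calc ∑ v ∈ nbr2 0, gaussProfile c t (w - v) ≤ ∑ _v ∈ nbr2 0, max A 0 * gaussProfile (c / 2) t w := by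
        refine Finset.sum_le_sum fun v hv => ?_
        rw [sub_eq_add_neg]
        refine (hA t ht w (-v) ?_).trans ?_
        · rw [elen_neg]; exact elen_le_two_of_mem_nbr2 hv
        · exact mul_le_mul_of_nonneg_right (le_max_left A 0) (gaussProfile_nonneg _ _ _)
    _ = (nbr2 0).card * (max A 0 * gaussProfile (c / 2) t w) := by rw [Finset.sum_const, nsmul_eq_mul]
    _ ≤ 81 * (max A 0 * gaussProfile (c / 2) t w) := by
        have := card_nbr2_le (0 : Site 4)
        exact mul_le_mul_of_nonneg_right (by exact_mod_cast this)
          (mul_nonneg (le_max_right A 0) (gaussProfile_nonneg _ _ _))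
    _ = 81 * max A 0 * gaussProfile (c / 2) t w := by ring

/-- **Weight absorption**: `(1+|w|)ʲ Γ_c(t,w) ≤ A (1+t)ᵏ Γ_{c/2}(t,w)` for `j ≤ 2k` (toolkit (3), `ε = 1/2`). -/
theorem exists_weight_gaussProfile_le
    (hT3 : ∀ c ε : ℝ, 0 < c → 0 < ε → ε < 1 → ∀ j : ℕ, ∃ A : ℝ, ∀ t : ℝ, 0 ≤ t → ∀ w : Site 4,
      elen w ^ j * gaussProfile c t w ≤ A * Real.sqrt (1 + t) ^ j * gaussProfile ((1 - ε) * c) t w)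
    {c : ℝ} (hc : 0 < c) {j k : ℕ} (hjk : j ≤ 2 * k) :
    ∃ A : ℝ, 0 ≤ A ∧ ∀ t : ℝ, 0 ≤ t → ∀ w : Site 4,
      (1 + elen w) ^ j * gaussProfile c t w ≤ A * (1 + t) ^ k * gaussProfile (c / 2) t w := by
  obtain ⟨A, hA⟩ := hT3 c (1 / 2) hc (by norm_num) (by norm_num) j
  have hc2 : (1 - 1 / 2) * c = c / 2 := by ring
  -- upgrade `A` to a nonnegative constant
  have hA' : ∀ t : ℝ, 0 ≤ t → ∀ w : Site 4,
      elen w ^ j * gaussProfile c t w ≤ max A 0 * Real.sqrt (1 + t) ^ j * gaussProfile ((1 - 1 / 2) * c) t w :=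
    fun t ht w => (hA t ht w).trans (by gcongr; exacts [gaussProfile_nonneg _ _ _, le_max_left A 0])
  refine ⟨2 ^ j * (1 + max A 0), by positivity, fun t ht w => ?_⟩
  have h := one_add_elen_pow_mul_gaussProfile_le hc.le (by norm_num : (0 : ℝ) ≤ 1 / 2) hA' t ht w
  rw [hc2] at h
  refine h.trans ?_
  have hΓ := gaussProfile_nonneg (c / 2) t w
  have := sqrt_one_add_pow_le ht hjk
  calc 2 ^ j * (1 + max A 0) * Real.sqrt (1 + t) ^ j * gaussProfile (c / 2) t w
      ≤ 2 ^ j * (1 + max A 0) * (1 + t) ^ k * gaussProfile (c / 2) t w := by gcongr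
    _ = _ := by ring

/-! ## §20 Entry bounds of `η`, `E₀`, `E₁` and of the first-order vertex on `E₁` -/

/-- Entries of the first-order kernel: `‖η(v)_{γδ}‖ ≤ 20736` for `v ∈ nbr2 0`. -/
theorem norm_eta_apply_le {v : Site 4} (hv : v ∈ nbr2 0) (γ δ : Fin 4) : ‖(η[v]) γ δ‖ ≤ 20736 := by
  rw [Matrix.sum_apply]
  refine (norm_sum_le _ _).trans ?_
  have hterm : ∀ z ∈ nbr 0, ‖(((wedge z v : ℤ) : ℂ) • (dsharp z * dsymb (v - z))) γ δ‖ ≤ 4 * (4 * 12 * 12) := by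
    intro z hz
    refine (norm_smul_apply_le _ (norm_mul_apply_le (norm_dsharp_apply_le z) (norm_dsymb_apply_le (v - z))) γ δ).trans ?_
    gcongr
    rw [← Complex.ofReal_intCast, Complex.norm_real, Real.norm_eq_abs]
    exact abs_wedge_le_four hz hv
  calc ∑ z ∈ nbr 0, ‖(((wedge z v : ℤ) : ℂ) • (dsharp z * dsymb (v - z))) γ δ‖
      ≤ ∑ _z ∈ nbr 0, (4 * (4 * 12 * 12) : ℝ) := Finset.sum_le_sum hterm
    _ = (nbr 0).card * (4 * (4 * 12 * 12) : ℝ) := by rw [Finset.sum_const, nsmul_eq_mul]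
    _ ≤ 9 * (4 * (4 * 12 * 12)) := by
        have := card_nbr_le (0 : Site 4)
        exact mul_le_mul_of_nonneg_right (by exact_mod_cast this) (by norm_num)
    _ = 20736 := by norm_num

/-- Entries of `E₀`: `‖(pert0 s y)_{γδ}‖ ≤ C_k Γ_c(s, y)`. -/
theorem norm_pert0_apply_le {Ck ck : ℝ}
    (hk : ∀ t : ℝ, 0 ≤ t → ∀ w : Site 4, |freeKer t w| ≤ Ck * gaussProfile ck t w)
    {s : ℝ} (hs : 0 ≤ s) (y : Site 4) (γ δ : Fin 4) : ‖pert0 s y γ δ‖ ≤ Ck * gaussProfile ck s y := by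
  rw [pert0, Matrix.smul_apply, smul_eq_mul, norm_mul, Complex.norm_real, Real.norm_eq_abs]
  calc |freeKer s y| * ‖(1 : Spin) γ δ‖ ≤ Ck * gaussProfile ck s y * 1 :=
        mul_le_mul (hk s hs y) (norm_one_apply_le γ δ) (norm_nonneg _)
          ((abs_nonneg _).trans (hk s hs y))
    _ = _ := mul_one _

/-- **Entries of `E₁`**: `‖(pert1 s y)_{γδ}‖ ≤ C₁ (1+s) Γ_{c/2}(s, y)` for `s ≥ 0`. -/
theorem exists_norm_pert1_apply_le {Ck ck : ℝ} (hck : 0 < ck)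
    (hk : ∀ t : ℝ, 0 ≤ t → ∀ w : Site 4, |freeKer t w| ≤ Ck * gaussProfile ck t w)
    (hT4 : ∀ c ε : ℝ, 0 < c → 0 < ε → ε < 1 → ∃ A : ℝ, ∀ t : ℝ, 0 ≤ t → ∀ w z : Site 4, elen z ≤ 2 →
      gaussProfile c t (w + z) ≤ A * gaussProfile ((1 - ε) * c) t w)
    (h1 : ∀ x y : Site 4, sqKer (fun _ => (1 : ℂ)) x y = ((hhat (y - x) : ℝ) : ℂ) • (1 : Spin))
    (h3 : ∀ w : Site 4, freeKer 0 w = if w = 0 then 1 else 0)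
    (h5 : ∀ s r : ℝ, 0 ≤ s → 0 ≤ r → ∀ w : Site 4,
      HasSum (fun y : Site 4 => freeKer s y * freeKer r (w - y)) (freeKer (s + r) w))
    (h6 : ∀ t : ℝ, 0 ≤ t → ∀ (w : Site 4) (ν : Fin 4),
      t * (∑ z ∈ nbr2 0, ((z ν : ℤ) : ℝ) * hhat z * freeKer t (w - z)) + ((w ν : ℤ) : ℝ) * freeKer t w = 0) :
    ∃ C₁ : ℝ, 0 ≤ C₁ ∧ ∀ s : ℝ, 0 ≤ s → ∀ (y : Site 4) (γ δ : Fin 4),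
      ‖pert1 s y γ δ‖ ≤ C₁ * (1 + s) * gaussProfile (ck / 2) s y := by
  obtain ⟨A, hA0, hA⟩ := exists_sum_nbr2_gaussProfile_le hT4 hck
  have hCk : 0 ≤ Ck := by
    have := hk 0 le_rfl 0
    have h0 : 0 < gaussProfile ck 0 0 := by rw [gaussProfile_zero_right]; norm_num
    nlinarith [abs_nonneg (freeKer 0 0)]
  refine ⟨10368 * Ck * A, by positivity, fun s hs y γ δ => ?_⟩
  rw [pert1_eq h1 h3 h5 h6 hs y, Matrix.neg_apply, norm_neg, Matrix.smul_apply, smul_eq_mul, norm_mul,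
    Complex.norm_real, Real.norm_eq_abs, abs_of_nonneg hs, Matrix.sum_apply]
  have hterm : ∀ v ∈ nbr2 0, ‖((Complex.I / 2 * ((freeKer s (y - v) : ℝ) : ℂ)) • η[v]) γ δ‖ ≤
      10368 * Ck * gaussProfile ck s (y - v) := by
    intro v hv
    refine (norm_smul_apply_le _ (norm_eta_apply_le hv) γ δ).trans ?_
    rw [norm_mul, norm_div, Complex.norm_I, Complex.norm_real, Real.norm_eq_abs]
    have := hk s hs (y - v)
    calc 1 / ‖(2 : ℂ)‖ * |freeKer s (y - v)| * 20736 ≤ 1 / ‖(2 : ℂ)‖ * (Ck * gaussProfile ck s (y - v)) * 20736 := by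
          gcongr
      _ = 10368 * Ck * gaussProfile ck s (y - v) := by simp; ring
  calc s * ‖∑ v ∈ nbr2 0, ((Complex.I / 2 * ((freeKer s (y - v) : ℝ) : ℂ)) • η[v]) γ δ‖
      ≤ s * ∑ v ∈ nbr2 0, 10368 * Ck * gaussProfile ck s (y - v) :=
        mul_le_mul_of_nonneg_left ((norm_sum_le _ _).trans (Finset.sum_le_sum hterm)) hs
    _ = s * (10368 * Ck * ∑ v ∈ nbr2 0, gaussProfile ck s (y - v)) := by rw [← Finset.mul_sum]
    _ ≤ (1 + s) * (10368 * Ck * (A * gaussProfile (ck / 2) s y)) := by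
        gcongr
        · exact mul_nonneg (by positivity) (Finset.sum_nonneg fun v _ => gaussProfile_nonneg _ _ _)
        · linarith
        · exact hA s hs y
    _ = _ := by ring

/-- **The first-order vertex on `E₁`** (exact form, no Moyal loss):
`‖(vtx 1 (pert1 s) w)_{γδ}‖ ≤ C (1+s) Γ_{c/4}(s, w)` for `s ≥ 0`. -/
theorem exists_norm_vtx_one_pert1_apply_le {Ck ck : ℝ} (hck : 0 < ck)
    (hk : ∀ t : ℝ, 0 ≤ t → ∀ w : Site 4, |freeKer t w| ≤ Ck * gaussProfile ck t w)
    (hT4 : ∀ c ε : ℝ, 0 < c → 0 < ε → ε < 1 → ∃ A : ℝ, ∀ t : ℝ, 0 ≤ t → ∀ w z : Site 4, elen z ≤ 2 →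
      gaussProfile c t (w + z) ≤ A * gaussProfile ((1 - ε) * c) t w)
    (h1 : ∀ x y : Site 4, sqKer (fun _ => (1 : ℂ)) x y = ((hhat (y - x) : ℝ) : ℂ) • (1 : Spin))
    (h3 : ∀ w : Site 4, freeKer 0 w = if w = 0 then 1 else 0)
    (h5 : ∀ s r : ℝ, 0 ≤ s → 0 ≤ r → ∀ w : Site 4,
      HasSum (fun y : Site 4 => freeKer s y * freeKer r (w - y)) (freeKer (s + r) w))
    (h6 : ∀ t : ℝ, 0 ≤ t → ∀ (w : Site 4) (ν : Fin 4),
      t * (∑ z ∈ nbr2 0, ((z ν : ℤ) : ℝ) * hhat z * freeKer t (w - z)) + ((w ν : ℤ) : ℝ) * freeKer t w = 0) :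
    ∃ C : ℝ, 0 ≤ C ∧ ∀ s : ℝ, 0 ≤ s → ∀ (w : Site 4) (γ δ : Fin 4),
      ‖vtx 1 (pert1 s) w γ δ‖ ≤ C * (1 + s) * gaussProfile (ck / 4) s w := by
  obtain ⟨A, hA0, hA⟩ := exists_sum_nbr2_gaussProfile_le hT4 hck
  obtain ⟨A', hA0', hA'⟩ := exists_sum_nbr2_gaussProfile_le hT4 (half_pos hck)
  have hc4 : ck / 2 / 2 = ck / 4 := by ring
  rw [hc4] at hA'
  have hCk : 0 ≤ Ck := by
    have := hk 0 le_rfl 0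
    have h0 : 0 < gaussProfile ck 0 0 := by rw [gaussProfile_zero_right]; norm_num
    nlinarith [abs_nonneg (freeKer 0 0)]
  -- entry bounds of the two matrix families
  have hηη : ∀ v ∈ nbr2 0, ∀ u ∈ nbr2 0, ∀ γ δ : Fin 4, ‖(η[v] * η[u]) γ δ‖ ≤ 4 * 20736 * 20736 :=
    fun v hv u hu γ δ => norm_mul_apply_le (norm_eta_apply_le hv) (norm_eta_apply_le hu) γ δ
  -- the double-shift kernel sum
  have hdouble : ∀ s : ℝ, 0 ≤ s → ∀ w : Site 4,
      ∑ v ∈ nbr2 0, ∑ u ∈ nbr2 0, gaussProfile ck s (w - v - u) ≤ A * A' * gaussProfile (ck / 4) s w := by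
    intro s hs w
    calc ∑ v ∈ nbr2 0, ∑ u ∈ nbr2 0, gaussProfile ck s (w - v - u)
        ≤ ∑ v ∈ nbr2 0, A * gaussProfile (ck / 2) s (w - v) := Finset.sum_le_sum fun v _ => hA s hs (w - v)
      _ = A * ∑ v ∈ nbr2 0, gaussProfile (ck / 2) s (w - v) := by rw [Finset.mul_sum]
      _ ≤ A * (A' * gaussProfile (ck / 4) s w) := mul_le_mul_of_nonneg_left (hA' s hs w) hA0
      _ = _ := by ring
  refine ⟨(4 * 20736 * 20736 + 8 * 20 * 20736) * Ck * (A * A'), by positivity, fun s hs w γ δ => ?_⟩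
  rw [vtx_one_pert1_eq h1 h3 h5 h6 hs w, Matrix.add_apply]
  refine (norm_add_le _ _).trans ?_
  -- first double sum
  have h1st : ‖(∑ v ∈ nbr2 0, ∑ u ∈ nbr2 0, ((s : ℂ) / 4 * ((freeKer s (w - v - u) : ℝ) : ℂ)) • (η[v] * η[u])) γ δ‖ ≤
      4 * 20736 * 20736 * Ck * s * ∑ v ∈ nbr2 0, ∑ u ∈ nbr2 0, gaussProfile ck s (w - v - u) := by
    rw [Matrix.sum_apply, Finset.mul_sum]
    refine (norm_sum_le _ _).trans (Finset.sum_le_sum fun v hv => ?_)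
    rw [Matrix.sum_apply, Finset.mul_sum]
    refine (norm_sum_le _ _).trans (Finset.sum_le_sum fun u hu => ?_)
    refine (norm_smul_apply_le _ (hηη v hv u hu) γ δ).trans ?_
    rw [norm_mul, norm_div, Complex.norm_real, Complex.norm_real, Real.norm_eq_abs, Real.norm_eq_abs,
      abs_of_nonneg hs]
    have := hk s hs (w - v - u)
    calc s / ‖(4 : ℂ)‖ * |freeKer s (w - v - u)| * (4 * 20736 * 20736)
        ≤ s / ‖(4 : ℂ)‖ * (Ck * gaussProfile ck s (w - v - u)) * (4 * 20736 * 20736) := by gcongr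
      _ ≤ s / 1 * (Ck * gaussProfile ck s (w - v - u)) * (4 * 20736 * 20736) := by
          gcongr
          · exact mul_nonneg hCk (gaussProfile_nonneg _ _ _)
          · simp
      _ = _ := by ring
  -- second double sum
  have h2nd : ‖(∑ v ∈ nbr2 0, ∑ u ∈ nbr2 0, ((s : ℂ) / 4 * ((wedge v u : ℤ) : ℂ) * ((hhat v : ℝ) : ℂ) *
      ((freeKer s (w - v - u) : ℝ) : ℂ)) • η[u]) γ δ‖ ≤
      8 * 20 * 20736 * Ck * s * ∑ v ∈ nbr2 0, ∑ u ∈ nbr2 0, gaussProfile ck s (w - v - u) := by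
    rw [Matrix.sum_apply, Finset.mul_sum]
    refine (norm_sum_le _ _).trans (Finset.sum_le_sum fun v hv => ?_)
    rw [Matrix.sum_apply, Finset.mul_sum]
    refine (norm_sum_le _ _).trans (Finset.sum_le_sum fun u hu => ?_)
    refine (norm_smul_apply_le _ (norm_eta_apply_le hu) γ δ).trans ?_
    rw [norm_mul, norm_mul, norm_mul, norm_div, Complex.norm_real, Complex.norm_real, Complex.norm_real,
      Real.norm_eq_abs, Real.norm_eq_abs, Real.norm_eq_abs, abs_of_nonneg hs, ← Complex.ofReal_intCast,
      Complex.norm_real, Real.norm_eq_abs]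
    have hw8 : |((wedge v u : ℤ) : ℝ)| ≤ 8 := by
      have := abs_wedge_le_four_mul_elen hv u
      have := elen_le_two_of_mem_nbr2 hu
      linarith
    have hh : |hhat v| ≤ 20 := by
      unfold hhat; split_ifs <;> norm_num
    have := hk s hs (w - v - u)
    calc s / ‖(4 : ℂ)‖ * |((wedge v u : ℤ) : ℝ)| * |hhat v| * |freeKer s (w - v - u)| * 20736
        ≤ s / ‖(4 : ℂ)‖ * 8 * 20 * (Ck * gaussProfile ck s (w - v - u)) * 20736 := by gcongr
      _ ≤ s / 1 * 8 * 20 * (Ck * gaussProfile ck s (w - v - u)) * 20736 := by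
          gcongr
          · exact mul_nonneg hCk (gaussProfile_nonneg _ _ _)
          · simp
      _ = _ := by ring
  have hsum := hdouble s hs w
  have hΓ := gaussProfile_nonneg (ck / 4) s w
  calc ‖(∑ v ∈ nbr2 0, ∑ u ∈ nbr2 0, ((s : ℂ) / 4 * ((freeKer s (w - v - u) : ℝ) : ℂ)) • (η[v] * η[u])) γ δ‖ +
        ‖(∑ v ∈ nbr2 0, ∑ u ∈ nbr2 0, ((s : ℂ) / 4 * ((wedge v u : ℤ) : ℂ) * ((hhat v : ℝ) : ℂ) *
          ((freeKer s (w - v - u) : ℝ) : ℂ)) • η[u]) γ δ‖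
      ≤ 4 * 20736 * 20736 * Ck * s * (A * A' * gaussProfile (ck / 4) s w) +
          8 * 20 * 20736 * Ck * s * (A * A' * gaussProfile (ck / 4) s w) := by
        refine add_le_add (h1st.trans ?_) (h2nd.trans ?_) <;>
          exact mul_le_mul_of_nonneg_left hsum (by positivity)
    _ = (4 * 20736 * 20736 + 8 * 20 * 20736) * Ck * (A * A') * s * gaussProfile (ck / 4) s w := by ring
    _ ≤ (4 * 20736 * 20736 + 8 * 20 * 20736) * Ck * (A * A') * (1 + s) * gaussProfile (ck / 4) s w := by
        gcongr; linarith

/-! ## Registered headline -/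

/-- Registered headline of this helper file (aux stub `stub_secondOrderExpansionAuxI` of crux
stmt-QuantumFields-16786, line `Sketch`): half-integer weight absorption by the profile. -/
theorem stub_secondOrderExpansionAuxI : ∀ (t : ℝ), 0 ≤ t → ∀ (j k : ℕ), j ≤ 2 * k → Real.sqrt (1 + t) ^ j ≤ (1 + t) ^ k :=
  fun _ ht _ _ hjk => sqrt_one_add_pow_le ht hjk

end Summit.QuantumFields.QCD.Cruxes.QuarkLoopCoefficient.Sketch.SecondOrderExpansion

end
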